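import Summits.CriticalPhenomena.SAWScalingLimit.Theorems.SAWDevelopingMapObservableToSLETypeLadderCarvedReductionSqueezeUniformizer
import Summits.CriticalPhenomena.SAWScalingLimit.Theorems.SAWDevelopingMapObservableToSLETypeLadderCarvedReductionSqueezeConfinedOuterHull
import Summits.CriticalPhenomena.SAWScalingLimit.Theorems.SAWDevelopingMapObservableToSLETypeLadderCarvedReductionSqueezeBulk
import Summits.CriticalPhenomena.SAWScalingLimit.Theorems.SAWDevelopingMapObservableToSLETypeLadderCarvedReductionSqueezeLimitUnion
import HarnessLib

/-!
# One step of the confined outer sequence (piece (T-A′₂F outer step) of stub T-A′₂F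
# `stub_carvedReduction_squeezeGeometry_domainsCoreF`)

Crux `SAWDevelopingMap.ObservableToSLE` (stmt-CriticalPhenomena-10472), line `six-class-type-ladder`,
stub T-A′₂F `stub_carvedReduction_squeezeGeometry_domainsCoreF`.  Landing target:
`Summits/CriticalPhenomena/SAWScalingLimit/Theorems/SAWDevelopingMapObservableToSLETypeLadderCarvedReductionSqueezeOuterStep.lean`.

The outer approximants `E_n` of the super-domain `E` (uniformizer `φ`, bulk `Ω ∋ b₀`) are built
recursively by T-A′₁ (`stub_carvedReduction_confinedOuterHull`).  At step `n` with zones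
`Z ⊆ Z'` (open, persistently removed, `Z` a positive distance inside `Z'` within `E`) the
`*`-hull is `A' := closure (ℍ ∖ φ.symm '' G')`, `G' := ` the `b₀`-component of
`E ∖ closure (Z' ∩ E)`, and the swallowed hull is `B := closure (ℍ ∖ φ.symm '' Gᴮ)`, `Gᴮ := ` the
`b₀`-component of `E_prev ∖ closure (Z ∩ E)` — both `*`-hulls by `bulkHull`, the complements of
the components being connected because every point of a zone lies in an OPEN connected piece of
the zone leaving `E` (`isConnected_union_closure_inter`).  Clause (a) of T-A′₁ then keeps all
of `G'` (so every point joined to `b₀` off `closure Z'` survives: this is how the reach clause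
(R) transfers), `pullbackHull E_prev ⊆ B ⊆ pullbackHull E_new` (monotonicity), `Z ∩ E` is
swallowed, and the new hull is `r/4`-deep in `A'`.  The one delicate input of T-A′₁, DEEPNESS of
`B` inside `A'` with its real points, comes (`exists_pos_forall_le_infDist_hull`) from the
Euclidean separation `dist (E ∖ Gᴮ, G') > 0` (`exists_le_dist_compl_component`): a merging pair
of sequences converges to a point `p`; inside `E` the margins `dist (Z, E ∖ Z') > 0`,
`dist (E ∖ E_prev, G_prev) > 0` (conformal deepness of the previous hull, `exists_le_dist_image`)
put `p` in the open set `E_prev ∖ closure (Z ∩ E)` where a ball meets `G' ⊆ Gᴮ`; on `∂E` the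
LOCAL BOUNDARY STRUCTURE (near `p`, `E` lies in `Z'` or in a region `X ⊆ Gᴮ`) concludes.
Main results: `exists_le_dist_compl_component`, `outerStep`.
Registered carrier: `stub_carvedReduction_outerStep`.
-/

noncomputable section

open scoped Topology
open Filter Set Metric Bornology
open UpperHalfPlane (upperHalfPlaneSet isOpen_upperHalfPlaneSet)
open Literature.Probability.RandomPlanarGeometry

namespace Summit.CriticalPhenomena.SAWScalingLimit.Theorems.ObservableToSLE.TypeLadder

/-! ### Attached zones: complements of bulk components are connected -/

/-- In an open preconnected `C` leaving the open set `E`, the component of `z ∈ C ∩ E` in `C ∩ E`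
has closure meeting `Eᶜ` (otherwise it would be relatively clopen in `C`). -/
theorem closure_component_inter_compl_nonempty {C E : Set ℂ} (hCo : IsOpen C) (hC : IsPreconnected C)
    (hE : IsOpen E) {z : ℂ} (hz : z ∈ C ∩ E) (hCE : (C \ E).Nonempty) :
    (closure (connectedComponentIn (C ∩ E) z) ∩ Eᶜ).Nonempty := by
  by_contra h
  set Q : Set ℂ := connectedComponentIn (C ∩ E) z with hQdef
  have hQE : closure Q ⊆ E := fun x hx => by_contra fun hxE => h ⟨x, hx, hxE⟩
  have hQo : IsOpen Q := (hCo.inter hE).connectedComponentIn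
  have hzQ : z ∈ Q := mem_connectedComponentIn hz
  -- `Q` is relatively closed in `C`
  have hQcl : closure Q ∩ C ⊆ Q := by
    rintro x ⟨hxQ, hxC⟩
    have h1 : IsPreconnected (insert x Q) :=
      isPreconnected_connectedComponentIn.subset_closure (subset_insert _ _) (insert_subset hxQ subset_closure)
    have h2 : insert x Q ⊆ C ∩ E := insert_subset ⟨hxC, hQE hxQ⟩ (connectedComponentIn_subset _ _)
    exact h1.subset_connectedComponentIn (mem_insert_of_mem _ hzQ) h2 (mem_insert _ _)
  obtain ⟨y, hyC, hyE⟩ := hCE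
  have hcover : C ⊆ Q ∪ (closure Q)ᶜ := fun x hxC => by
    by_cases hx : x ∈ closure Q
    · exact Or.inl (hQcl ⟨hx, hxC⟩)
    · exact Or.inr hx
  obtain ⟨w, -, hwQ, hwncl⟩ := hC Q (closure Q)ᶜ hQo isClosed_closure.isOpen_compl hcover ⟨z, hz.1, hzQ⟩
    ⟨y, hyC, fun hy => hyE (hQE hy)⟩
  exact hwncl (subset_closure hwQ)

/-- **`F ∪ closure (Z ∩ E)` is connected** for a connected `F ⊇ Eᶜ` (`E` open), when every point of
`Z ∩ E` lies in an open preconnected piece of `Z` leaving `E`. -/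
theorem isConnected_union_closure_inter {F Z E : Set ℂ} (hF : IsConnected F) (hEF : Eᶜ ⊆ F) (hE : IsOpen E)
    (hatt : ∀ z ∈ Z ∩ E, ∃ C : Set ℂ, IsOpen C ∧ IsPreconnected C ∧ z ∈ C ∧ C ⊆ Z ∧ (C \ E).Nonempty) :
    IsConnected (F ∪ closure (Z ∩ E)) := by
  classical
  choose! C hCo hCc hzC hCZ hCE using hatt
  set Q : ℂ → Set ℂ := fun z => connectedComponentIn (C z ∩ E) z with hQdef
  set T' : Set ℂ := F ∪ ⋃ z ∈ Z ∩ E, closure (Q z) with hT'def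
  obtain ⟨x₀, hx₀⟩ := hF.nonempty
  have hQZ : ∀ z ∈ Z ∩ E, Q z ⊆ Z ∩ E := fun z hz =>
    (connectedComponentIn_subset _ _).trans (inter_subset_inter_left _ (hCZ z hz))
  -- `T'` is preconnected
  have hT' : IsPreconnected T' := by
    refine isPreconnected_of_forall x₀ fun y hy => ?_
    rcases hy with hyF | hyU
    · exact ⟨F, subset_union_left, hx₀, hyF, hF.isPreconnected⟩
    · rw [mem_iUnion₂] at hyU
      obtain ⟨z, hz, hyz⟩ := hyU
      obtain ⟨p, hpQ, hpE⟩ := closure_component_inter_compl_nonempty (hCo z hz) (hCc z hz) hE ⟨hzC z hz, hz.2⟩ (hCE z hz)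
      refine ⟨F ∪ closure (Q z), union_subset subset_union_left fun w hw => ?_, Or.inl hx₀, Or.inr hyz, ?_⟩
      · exact Or.inr (mem_iUnion₂.2 ⟨z, hz, hw⟩)
      · exact IsPreconnected.union p (hEF hpE) hpQ hF.isPreconnected isPreconnected_connectedComponentIn.closure
  -- `T' ⊆ F ∪ closure (Z ∩ E) ⊆ closure T'`
  have h1 : T' ⊆ F ∪ closure (Z ∩ E) := by
    refine union_subset subset_union_left fun w hw => ?_
    rw [mem_iUnion₂] at hw
    obtain ⟨z, hz, hw⟩ := hw
    exact Or.inr (closure_mono (hQZ z hz) hw)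
  have h2 : F ∪ closure (Z ∩ E) ⊆ closure T' := by
    refine union_subset (subset_union_left.trans subset_closure) (closure_minimal (fun w hw => ?_) isClosed_closure)
    exact subset_closure (Or.inr (mem_iUnion₂.2 ⟨w, hw, subset_closure (mem_connectedComponentIn ⟨hzC w hw, hw.2⟩)⟩))
  exact ⟨⟨x₀, Or.inl hx₀⟩, hT'.subset_closure h1 h2⟩

/-! ### The Euclidean separation of `E ∖ Gᴮ` from `G'` -/

/-- **`dist (E ∖ Gᴮ, G') > 0`.**  `E` bounded open, `E_p` open, `Gᴮ` the `b₀`-component of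
`E_p ∖ closure (Z ∩ E)`; `G' ⊆ Gᴮ` with `G' ⊆ G_p ∩ (E ∖ Z')`; margins `dist (Z ∩ E, E ∖ Z') ≥ d₁`,
`dist (E ∖ E_p, G_p) ≥ d₂`; a region `X ⊆ Gᴮ`; and the local boundary structure: near every
`p ∈ ∂E`, `E` lies in `Z'` or in `X`. -/
theorem exists_le_dist_compl_component {E Ep Gp G' Z Z' X : Set ℂ} {b₀ : ℂ} {d₁ d₂ : ℝ}
    (hEbd : IsBounded E) (hEp : IsOpen Ep)
    (hG'Gp : G' ⊆ Gp) (hG'E : G' ⊆ E \ Z')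
    (hG'B : G' ⊆ connectedComponentIn (Ep \ closure (Z ∩ E)) b₀)
    (hd₁ : 0 < d₁) (hmargin : ∀ a ∈ Z ∩ E, ∀ b ∈ E \ Z', d₁ ≤ dist a b)
    (hd₂ : 0 < d₂) (hsep₂ : ∀ a ∈ E \ Ep, ∀ b ∈ Gp, d₂ ≤ dist a b)
    (hX : X ⊆ connectedComponentIn (Ep \ closure (Z ∩ E)) b₀)
    (hLBS : ∀ p ∈ frontier E, ∃ N ∈ 𝓝 p, N ∩ E ⊆ Z' ∨ N ∩ E ⊆ X) :
    ∃ d > (0 : ℝ), ∀ a ∈ E \ connectedComponentIn (Ep \ closure (Z ∩ E)) b₀,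
      ∀ b ∈ G', d ≤ dist a b := by
  set O : Set ℂ := Ep \ closure (Z ∩ E) with hOdef
  set GB : Set ℂ := connectedComponentIn O b₀ with hGBdef
  have hOo : IsOpen O := hEp.sdiff isClosed_closure
  by_contra hcon
  push Not at hcon
  have hseq : ∀ k : ℕ, ∃ a ∈ E \ GB, ∃ b ∈ G', dist a b < 1 / ((k : ℝ) + 1) := fun k =>
    hcon (1 / ((k : ℝ) + 1)) (by positivity)
  choose a ha b hb hab using hseq
  obtain ⟨p, hp, σ, hσ, halim⟩ := hEbd.isCompact_closure.tendsto_subseq fun k => subset_closure (ha k).1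
  have hdist0 : Tendsto (fun k => dist (a (σ k)) (b (σ k))) atTop (𝓝 0) := by
    have h1 : Tendsto (fun k : ℕ => 1 / ((k : ℝ) + 1)) atTop (𝓝 0) := tendsto_one_div_add_atTop_nhds_zero_nat
    exact squeeze_zero (fun k => dist_nonneg) (fun k => (hab (σ k)).le) (h1.comp hσ.tendsto_atTop)
  have hblim : Tendsto (fun k => b (σ k)) atTop (𝓝 p) := by
    rw [tendsto_iff_dist_tendsto_zero] at halim ⊢
    refine squeeze_zero (fun k => dist_nonneg) (fun k => ?_) (by simpa using hdist0.add halim)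
    calc dist (b (σ k)) p ≤ dist (b (σ k)) (a (σ k)) + dist (a (σ k)) p := dist_triangle _ _ _
      _ = dist (a (σ k)) (b (σ k)) + dist (a (σ k)) p := by rw [dist_comm]
  have hbnear : ∀ ε > (0 : ℝ), ∀ᶠ k in atTop, dist (b (σ k)) p < ε := fun ε hε =>
    (tendsto_iff_dist_tendsto_zero.1 hblim).eventually (gt_mem_nhds hε)
  -- it suffices that `a (σ k) ∈ Gᴮ` eventually
  suffices h : ∀ᶠ k in atTop, a (σ k) ∈ GB by
    obtain ⟨k, hk⟩ := h.exists
    exact (ha (σ k)).2 hk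
  by_cases hpE : p ∈ E
  · -- `p ∈ E_p`
    have hpEp : p ∈ Ep := by
      by_contra hpEp
      obtain ⟨k, hk⟩ := (hbnear d₂ hd₂).exists
      have := hsep₂ p ⟨hpE, hpEp⟩ (b (σ k)) (hG'Gp (hb (σ k)))
      rw [dist_comm] at hk
      linarith
    -- `p ∉ closure (Z ∩ E)`
    have hpZ : p ∉ closure (Z ∩ E) := by
      intro hpZ
      obtain ⟨a', ha'Z, ha'p⟩ := Metric.mem_closure_iff.1 hpZ (d₁ / 2) (half_pos hd₁)
      obtain ⟨k, hk⟩ := (hbnear (d₁ / 2) (half_pos hd₁)).exists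
      have h1 := hmargin a' ha'Z (b (σ k)) (hG'E (hb (σ k)))
      have h2 := dist_triangle a' p (b (σ k))
      rw [dist_comm p] at h2
      rw [dist_comm] at ha'p
      linarith
    obtain ⟨ε, hε, hball⟩ := Metric.isOpen_iff.1 hOo p ⟨hpEp, hpZ⟩
    have hballGB : ball p ε ⊆ GB := by
      obtain ⟨k, hk⟩ := (hbnear ε hε).exists
      exact subset_bulk_of_mem (convex_ball p ε).isPreconnected hball (mem_ball.2 hk) (hG'B (hb (σ k)))
    filter_upwards [halim.eventually_mem (ball_mem_nhds p hε)] with k hk using hballGB hk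
  · have hpfr : p ∈ frontier E := by
      rw [closure_eq_self_union_frontier] at hp
      exact hp.resolve_left hpE
    obtain ⟨N, hN, hNalt⟩ := hLBS p hpfr
    rcases hNalt with hNZ | hNX
    · exfalso
      obtain ⟨k, hk⟩ := (hblim.eventually_mem hN).exists
      have hbk := hG'E (hb (σ k))
      exact hbk.2 (hNZ ⟨hk, hbk.1⟩)
    · filter_upwards [halim.eventually_mem hN] with k hk using hX (hNX ⟨hk, (ha (σ k)).1⟩)

/-! ### The step -/

/-- **ONE STEP OF THE CONFINED OUTER SEQUENCE**; see the module docstring.  Inputs: the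
super-domain `E` with uniformizer `φ`, the bulk `Ω ∋ b₀` (open, connected, containing the germs
of `E` at the marked points), the zones `Z ⊆ Z'` of the step with their attachment, margin and
local-boundary-structure data, a region `X` (`b₀ ∈ X ⊆ E`, off `closure (Z ∩ E)`), and the
previous stage: a hull subdomain `E_p` with a region `G_p ⊆ E_p` containing `X` and the current
good component `G'`, and the previous hull `r_p`-deep off `closure (φ.symm '' G_p)`.  Output: the
next hull subdomain `E_n` with its deepness radius. -/
theorem outerStep (E : DobrushinDomain) (φ : ConformalEquiv upperHalfPlaneSet E.carrier)
    (hφ : E.IsChordalUniformizing φ) {Ω : Set ℂ} {b₀ : ℂ} (hΩc : IsConnected Ω)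
    (hΩE : Ω ⊆ E.carrier) (hb₀ : b₀ ∈ Ω) (hwin : ∀ i : Fin 2, ∃ W ∈ 𝓝 (E.pt i), W ∩ E.carrier ⊆ Ω)
    {Z Z' X : Set ℂ} (hZZ' : Z ⊆ Z') (hΩZ' : Disjoint Ω (closure (Z' ∩ E.carrier)))
    (hatt : ∀ z ∈ Z ∩ E.carrier, ∃ C : Set ℂ, IsOpen C ∧ IsPreconnected C ∧ z ∈ C ∧ C ⊆ Z ∧ (C \ E.carrier).Nonempty)
    (hatt' : ∀ z ∈ Z' ∩ E.carrier, ∃ C : Set ℂ, IsOpen C ∧ IsPreconnected C ∧ z ∈ C ∧ C ⊆ Z' ∧ (C \ E.carrier).Nonempty)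
    {d₁ : ℝ} (hd₁ : 0 < d₁) (hmargin : ∀ a ∈ Z ∩ E.carrier, ∀ b ∈ E.carrier \ Z', d₁ ≤ dist a b)
    (hXc : IsPreconnected X) (hXb : b₀ ∈ X) (hXZ : Disjoint X (closure (Z ∩ E.carrier)))
    (hLBS : ∀ p ∈ frontier E.carrier, ∃ N ∈ 𝓝 p, N ∩ E.carrier ⊆ Z' ∨ N ∩ E.carrier ⊆ X)
    (Ep : DobrushinDomain) (hEp : E.IsHullSubdomain Ep) {Gp : Set ℂ} (hGpEp : Gp ⊆ Ep.carrier)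
    (hXGp : X ⊆ Gp) (hG'Gp : connectedComponentIn (E.carrier \ closure (Z' ∩ E.carrier)) b₀ ⊆ Gp)
    {rp : ℝ} (hrp : 0 < rp) (hdeep : ∀ w ∈ φ.pullbackHull Ep, rp ≤ infDist w (closure (φ.symm '' Gp))) :
    ∃ (En : DobrushinDomain) (r : ℝ), E.IsHullSubdomain En ∧ 0 < r ∧
      (∀ w ∈ φ.pullbackHull En, r / 4 ≤
        infDist w (closure (φ.symm '' connectedComponentIn (E.carrier \ closure (Z' ∩ E.carrier)) b₀))) ∧
      connectedComponentIn (E.carrier \ closure (Z' ∩ E.carrier)) b₀ ⊆ En.carrier ∧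
      φ.pullbackHull En ⊆
        closure (upperHalfPlaneSet \ φ.symm '' connectedComponentIn (E.carrier \ closure (Z' ∩ E.carrier)) b₀) ∧
      Disjoint (Z ∩ E.carrier) En.carrier ∧
      φ.pullbackHull Ep ⊆ φ.pullbackHull En := by
  classical
  have hsc : ∀ D₀ : JordanDomain, D₀.isSimplyConnected := JordanDomain.isSimplyConnected_holds
  set G' : Set ℂ := connectedComponentIn (E.carrier \ closure (Z' ∩ E.carrier)) b₀ with hG'def
  set O : Set ℂ := Ep.carrier \ closure (Z ∩ E.carrier) with hOdef
  set GB : Set ℂ := connectedComponentIn O b₀ with hGBdef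
  -- the good component `G'`
  have hEpE : Ep.carrier ⊆ E.carrier := hEp.carrier_subset
  have hO'o : IsOpen (E.carrier \ closure (Z' ∩ E.carrier)) := E.isOpen.sdiff isClosed_closure
  have hOo : IsOpen O := Ep.isOpen.sdiff isClosed_closure
  have hΩO' : Ω ⊆ E.carrier \ closure (Z' ∩ E.carrier) := fun z hz => ⟨hΩE hz, disjoint_left.1 hΩZ' hz⟩
  have hΩG' : Ω ⊆ G' := window_subset_bulk hΩc.isPreconnected hΩO' hb₀
  have hG'E : G' ⊆ E.carrier := fun z hz => (connectedComponentIn_subset _ _ hz).1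
  have hG'EZ : G' ⊆ E.carrier \ Z' := fun z hz =>
    ⟨hG'E hz, fun hzZ => (connectedComponentIn_subset _ _ hz).2 (subset_closure ⟨hzZ, hG'E hz⟩)⟩
  have hG'o : IsOpen G' := hO'o.connectedComponentIn
  have hb₀G' : b₀ ∈ G' := hΩG' hb₀
  have hG'c : IsConnected G' := ⟨⟨b₀, hb₀G'⟩, isPreconnected_connectedComponentIn⟩
  -- the swallowed component `Gᴮ`
  have hΩEp : Ω ⊆ Ep.carrier := (hΩG'.trans hG'Gp).trans hGpEp
  have hZcl : closure (Z ∩ E.carrier) ⊆ closure (Z' ∩ E.carrier) := closure_mono (inter_subset_inter_left _ hZZ')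
  have hΩO : Ω ⊆ O := fun z hz => ⟨hΩEp hz, fun h => disjoint_left.1 hΩZ' hz (hZcl h)⟩
  have hΩGB : Ω ⊆ GB := window_subset_bulk hΩc.isPreconnected hΩO hb₀
  have hb₀GB : b₀ ∈ GB := hΩGB hb₀
  have hGBO : GB ⊆ O := connectedComponentIn_subset _ _
  have hGBEp : GB ⊆ Ep.carrier := fun z hz => (hGBO hz).1
  have hGBE : GB ⊆ E.carrier := hGBEp.trans hEpE
  have hGBo : IsOpen GB := hOo.connectedComponentIn
  have hGBc : IsConnected GB := ⟨⟨b₀, hb₀GB⟩, isPreconnected_connectedComponentIn⟩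
  have hG'O : G' ⊆ O := fun z hz => ⟨hGpEp (hG'Gp hz), fun h => (connectedComponentIn_subset _ _ hz).2 (hZcl h)⟩
  have hG'GB : G' ⊆ GB := subset_bulk_of_mem hG'c.isPreconnected hG'O hb₀G' hb₀GB
  have hXO : X ⊆ O := fun z hz => ⟨hGpEp (hXGp hz), disjoint_left.1 hXZ hz⟩
  have hXGB : X ⊆ GB := subset_bulk_of_mem hXc hXO hXb hb₀GB
  -- windows and connected complements
  have hwinG' : ∀ i : Fin 2, ∃ W ∈ 𝓝 (E.pt i), W ∩ E.carrier ⊆ G' := fun i =>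
    let ⟨W, hW, h⟩ := hwin i; ⟨W, hW, h.trans hΩG'⟩
  have hwinGB : ∀ i : Fin 2, ∃ W ∈ 𝓝 (E.pt i), W ∩ E.carrier ⊆ GB := fun i =>
    let ⟨W, hW, h⟩ := hwin i; ⟨W, hW, h.trans hΩGB⟩
  have hEc : IsConnected E.carrierᶜ := ⟨⟨E.pt 0, E.pt_notMem_carrier 0⟩, E.isPreconnected_compl⟩
  have hEpc : IsConnected Ep.carrierᶜ := ⟨⟨Ep.pt 0, Ep.pt_notMem_carrier 0⟩, Ep.isPreconnected_compl⟩
  have hG'cc : IsConnected G'ᶜ := by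
    refine isConnected_compl_connectedComponentIn hO'o ?_ b₀
    rw [Set.sdiff_eq, compl_inter, compl_compl]
    exact isConnected_union_closure_inter hEc Subset.rfl E.isOpen hatt'
  have hGBcc : IsConnected GBᶜ := by
    refine isConnected_compl_connectedComponentIn hOo ?_ b₀
    rw [hOdef, Set.sdiff_eq, compl_inter, compl_compl]
    exact isConnected_union_closure_inter hEpc (compl_subset_compl.2 hEpE) E.isOpen hatt
  -- the two `*`-hulls
  obtain ⟨hA'star, hHA', -, -, -, -⟩ := bulkHull E φ G' hφ hG'o hG'c hG'E hwinG' hG'cc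
  obtain ⟨hBstar, -, -, -, -, -⟩ := bulkHull E φ GB hφ hGBo hGBc hGBE hwinGB hGBcc
  set A' : Set ℂ := closure (upperHalfPlaneSet \ φ.symm '' G') with hA'def
  set B : Set ℂ := closure (upperHalfPlaneSet \ φ.symm '' GB) with hBdef
  -- separation (ii): `dist (E ∖ E_p, G_p) > 0` from the conformal deepness of the previous hull
  have hGpE : Gp ⊆ E.carrier := hGpEp.trans hEpE
  have hPstar : IsStarHull (φ.pullbackHull Ep) := IsStarHull.pullbackHull hsc hφ hEp
  obtain ⟨d₂, hd₂, hsep₂⟩ : ∃ d₂ > (0 : ℝ), ∀ a ∈ E.carrier \ Ep.carrier, ∀ b ∈ Gp, d₂ ≤ dist a b := by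
    have hdisj : Disjoint (φ.pullbackHull Ep) (closure (φ.symm '' Gp)) := by
      rw [disjoint_left]
      intro w hw hwcl
      have h1 := hdeep w hw
      rw [infDist_zero_of_mem hwcl] at h1
      linarith
    obtain ⟨d₂, hd₂, h⟩ := exists_le_dist_image hφ hPstar.isBoundedHull.isCompact
      hPstar.isBoundedHull.subset_closure (symm_image_subset hGpE) hdisj
    refine ⟨d₂, hd₂, fun a ha b hb => ?_⟩
    have haH : φ.symm a ∈ upperHalfPlaneSet := φ.symm_mapsTo ha.1
    have h1 : φ.symm a ∈ φ.pullbackHull Ep := by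
      have h2 : φ.symm a ∈ φ.pullbackHull Ep ∩ upperHalfPlaneSet := by
        rw [ConformalEquiv.pullbackHull_inter]
        refine ⟨haH, fun h => ha.2 ?_⟩
        have h3 := h.2
        rwa [φ.apply_symm_apply ha.1] at h3
      exact h2.1
    have h2 := h (φ.symm a) h1 haH (φ.symm b) ⟨b, hb, rfl⟩
    rwa [φ.apply_symm_apply ha.1, φ.apply_symm_apply (hGpE hb)] at h2
  -- the Euclidean separation of `E ∖ Gᴮ` from `G'`, and the deepness of `B` inside `A'`
  obtain ⟨d, hd, hsep⟩ := exists_le_dist_compl_component E.isBounded Ep.isOpen hG'Gp hG'EZ hG'GB hd₁ hmargin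
    hd₂ hsep₂ hXGB hLBS
  obtain ⟨r, hr, hrdeep⟩ := exists_pos_forall_le_infDist_hull hGBE hG'E ⟨b₀, hb₀G'⟩
    hBstar.isBoundedHull.isCompact hd hsep
  obtain ⟨Rb, hRb⟩ := hBstar.isBoundedHull.1.subset_closedBall 0
  have hdeepB : ∀ w ∈ B, r ≤ infDist w (closure (upperHalfPlaneSet \ A')) := by
    rw [hHA']; exact hrdeep
  -- T-A′₁
  obtain ⟨En, hEn, hkeep, -, hBP, hPA, hPdeep⟩ := stub_carvedReduction_confinedOuterHull E φ A' B univ r (max Rb 0) 1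
    hφ hA'star hBstar hr (le_max_right _ _) one_pos hdeepB isOpen_univ (subset_univ _)
    (hRb.trans (closedBall_subset_closedBall (le_max_left _ _)))
  refine ⟨En, r, hEn, hr, fun w hw => ?_, fun z hz => ?_, hPA, ?_, ?_⟩
  · have h1 := hPdeep w hw
    rwa [hHA'] at h1
  · have hw : φ.symm z ∈ upperHalfPlaneSet := φ.symm_mapsTo (hG'E hz)
    have h0 : infDist (φ.symm z) (closure (upperHalfPlaneSet \ A')) ≤ r / 4 := by
      rw [hHA', infDist_zero_of_mem (subset_closure (mem_image_of_mem φ.symm hz) : φ.symm z ∈ closure (φ.symm '' G'))]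
      positivity
    have h1 := hkeep (φ.symm z) hw h0
    rwa [φ.apply_symm_apply (hG'E hz)] at h1
  · rw [disjoint_left]
    rintro z ⟨hzZ, hzE⟩ hzEn
    have hw : φ.symm z ∈ upperHalfPlaneSet := φ.symm_mapsTo hzE
    have hwdom : φ.symm z ∈ φ.pullbackDomain En := ⟨hw, by rw [φ.apply_symm_apply hzE]; exact hzEn⟩
    have hwB : φ.symm z ∈ B := by
      refine subset_closure ⟨hw, fun h => ?_⟩
      have h1 : z ∈ GB := by
        have h2 := (mem_symm_image_iff hGBE hw).1 h
        rwa [φ.apply_symm_apply hzE] at h2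
      exact (hGBO h1).2 (subset_closure ⟨hzZ, hzE⟩)
    have hwP : φ.symm z ∈ φ.pullbackHull En := hBP hwB
    rw [ConformalEquiv.pullbackHull, mem_closure_iff_nhds] at hwP
    obtain ⟨u, hu, hu'⟩ := hwP _ (ConformalEquiv.isOpen_pullbackDomain.mem_nhds hwdom)
    exact hu'.2 hu
  · refine subset_trans (closure_mono ?_) hBP
    rintro w ⟨hw, hwdom⟩
    refine ⟨hw, fun h => hwdom ⟨hw, ?_⟩⟩
    exact hGBEp ((mem_symm_image_iff hGBE hw).1 h)

/-- **Registered carrier `stub_carvedReduction_outerStep`** (crux item stmt-CriticalPhenomena-10472,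
stub T-A′₂F `stub_carvedReduction_squeezeGeometry_domainsCoreF`, piece THE OUTER STEP): in an open
preconnected `C` leaving the open set `E`, the component of `z ∈ C ∩ E` in `C ∩ E` has closure
meeting `Eᶜ`. -/
theorem stub_carvedReduction_outerStep :
    ∀ (C E : Set ℂ) (z : ℂ), IsOpen C → IsPreconnected C → IsOpen E → z ∈ C ∩ E → (C \ E).Nonempty →
      (closure (connectedComponentIn (C ∩ E) z) ∩ Eᶜ).Nonempty :=
  fun _ _ _ hCo hC hE hz hCE => closure_component_inter_compl_nonempty hCo hC hE hz hCE

end Summit.CriticalPhenomena.SAWScalingLimit.Theorems.ObservableToSLE.TypeLadder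

end
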